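import Summits.NavierStokesRegularity.NavierStokesRegularity.Theorems.AdaptedFrequencyAdaptedKernelExistsUpperOfMomentsBarrier

/-!
# Crux `AdaptedKernelExists` (stmt-NavierStokesRegularity-2956), line `nash-entropy-last-block`:
  the COMPARISON FROM ABOVE for STUB `stub_prekernelBounds`

Helper file (lands `--supports stmt-NavierStokesRegularity-2956`) for the registered stub
`stub_prekernelBounds` of the line's skeleton (positivity and the upper comparison for the smooth
representative `g` of `Γ + w`). It is the comparison step of the accepted
`upperOfMoments_comparison` (file `…UpperOfMomentsBarrier`), rewritten for a function `G` that
is NOT assumed to be an adapted backward kernel: the only inputs are the membership of the reversed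
rescaled function `v(σ) = G(t₁ − σ/ν)` in the tree's local drift–heat class on the block
`σ ∈ [0, ν(t₁ − t)]` (drift bound `B/ν`), the nonnegativity, continuity and integrability of the
top slice `G(t₁, ·)`, and the uniform decay of `G` at spatial infinity on the block. For a general
finite-dimensional inner product space `E` (the approximate identity
`upperOfMoments_exists_sub_le_heatExtension`, the barrier domination
`upperOfMoments_heatExtension_le_driftKernelBarrier` and the integrability
`upperOfMoments_integrable_mul_driftKernel` are imported from `…UpperOfMomentsBarrier`):

* `prekernel_comparison`: for every `x` and `δ > 0` there is an age offset `σ₀ ∈ (0, ν(t₁ − t)]`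
  with `G(t, x) ≤ ∫ G(t₁, z) k₊(ν(t₁ − t) + σ₀, x − z) dz + δ` — the tree's comparison principle
  `IsDriftHeatSolutionOn.paraboloid_comparison` for `−v` on a large cylinder with the classical
  subsolution `−Ψ₊(σ + σ₀) − δ` (`driftKernelBarrier_ineq`, `ε = 1`).

Its `ℝ³` form `stub_prekernelBounds_comparison` is a registered sub-goal of the crux item.
-/

noncomputable section

open MeasureTheory Set Filter Topology Metric Function Real
open scoped Laplacian
open Literature.Analysis.FluidPDE Literature.Analysis.UnboundedOperators

namespace Summit.NavierStokesRegularity.NavierStokesRegularity.Theorems.AdaptedKernelExists.NashEntropyLastBlock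

section General

variable {E : Type*} [NormedAddCommGroup E] [InnerProductSpace ℝ E] [FiniteDimensional ℝ E]
  [MeasurableSpace E] [BorelSpace E]

/-! ### The comparison from above -/

/-- **Comparison from above on a block, for the local class.** Let `G : ℝ → E → ℝ`, `t < t₁`,
`ν > 0`, `B ≥ 0`, and suppose: the reversed rescaled function `v(σ) = G(t₁ − σ/ν)` belongs to
the local drift–heat class `IsDriftHeatSolutionOn a v (B/ν) (Icc 0 (ν(t₁ − t))) univ` for some
drift `a`; the top slice `G(t₁, ·)` is nonnegative, continuous and integrable; and `G(s, y) ≤ δ`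
for `‖y − x₀‖ ≥ ρ₀(δ)`, uniformly in `s ∈ [t, t₁]`. Then for every `x` and `δ > 0` there is
`σ₀ ∈ (0, ν(t₁ − t)]` with `G(t, x) ≤ ∫ G(t₁, z) k₊(ν(t₁ − t) + σ₀, x − z) dz + δ`,
`k₊ = driftKernel 1 (B/ν)`. Proof: compare `−v` on the cylinder `[0, ν(t₁ − t)] × B̄(x₀, ρ)`
with the classical subsolution `−Ψ₊(σ + σ₀) − δ`, `Ψ₊ = k₊ ⋆ (ψ · G(t₁))` (`ψ` a bump of
`B̄(x₀, ρ) ⊂ B̄(x₀, ρ + 1)`; `driftKernelBarrier_ineq` with `ε = 1`), which lies below `−v` at the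
bottom (`e^{σ₀Δ} h ≥ h − δ` on the ball, `Ψ₊ ≥ e^{σ₀Δ} h`) and on the side (`v ≤ δ` there for
`ρ ≥ ρ₀(δ)`, `Ψ₊ ≥ 0`), by `IsDriftHeatSolutionOn.paraboloid_comparison`; at `σ = ν(t₁ − t)`
and the centre region this is `G(t, x) ≤ Ψ₊(ν(t₁ − t) + σ₀, x) + δ ≤ ∫ G(t₁) k₊(…, x − ·) + δ`.
-/
theorem prekernel_comparison {ν t t₁ B : ℝ} {x₀ : E} {G : ℝ → E → ℝ}
    (hν : 0 < ν) (htt₁ : t < t₁) (hB0 : 0 ≤ B)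
    (hv : ∃ a : ℝ → E → E,
      IsDriftHeatSolutionOn a (fun σ => G (t₁ - σ / ν)) (B / ν) (Icc 0 (ν * (t₁ - t))) univ)
    (hG0 : ∀ z, 0 ≤ G t₁ z) (hGc : Continuous (G t₁)) (hGi : Integrable (G t₁))
    (hdecay : ∀ δ : ℝ, 0 < δ → ∃ ρ₀ : ℝ, ∀ s ∈ Icc t t₁, ∀ y, ρ₀ ≤ ‖y - x₀‖ → G s y ≤ δ)
    (x : E) {δ : ℝ} (hδ : 0 < δ) :
    ∃ σ₀ : ℝ, 0 < σ₀ ∧ σ₀ ≤ ν * (t₁ - t) ∧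
      G t x ≤ (∫ z, G t₁ z * driftKernel 1 (B / ν) (ν * (t₁ - t) + σ₀) (x - z)) + δ := by
  obtain ⟨a, hv⟩ := hv
  have hg := hv.neg
  have hA : 0 ≤ B / ν := div_nonneg hB0 hν.le
  have hστ : 0 < ν * (t₁ - t) := mul_pos hν (by linarith)
  -- the radius of the cylinder
  obtain ⟨ρ₀, hρ₀⟩ := hdecay δ hδ
  obtain ⟨ρ, hρ⟩ : ∃ ρ : ℝ, ρ = max ρ₀ ‖x - x₀‖ + 1 := ⟨_, rfl⟩
  have hρx : ‖x - x₀‖ ≤ ρ := by rw [hρ]; linarith [le_max_right ρ₀ ‖x - x₀‖]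
  have hρρ₀ : ρ₀ ≤ ρ := by rw [hρ]; linarith [le_max_left ρ₀ ‖x - x₀‖]
  have hρ0 : 0 < ρ := by rw [hρ]; linarith [le_max_right ρ₀ ‖x - x₀‖, norm_nonneg (x - x₀)]
  -- the weight `hw = ψ · G(t₁)`
  let ψ : ContDiffBump x₀ := ⟨ρ, ρ + 1, hρ0, by linarith⟩
  obtain ⟨hw, hhw⟩ : ∃ hw : E → ℝ, hw = fun z => ψ z * G t₁ z := ⟨_, rfl⟩
  have hwc : Continuous hw := by
    rw [hhw]; exact ψ.continuous.mul hGc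
  have hw0 : ∀ z, 0 ≤ hw z := fun z => by rw [hhw]; exact mul_nonneg ψ.nonneg (hG0 z)
  have hwG : ∀ z, hw z ≤ G t₁ z := fun z => by
    rw [hhw]
    calc ψ z * G t₁ z ≤ 1 * G t₁ z := mul_le_mul_of_nonneg_right ψ.le_one (hG0 z)
      _ = G t₁ z := one_mul _
  have hws : HasCompactSupport hw := by
    rw [hhw]; exact hasCompactSupport_mul_lambda ψ.hasCompactSupport
  have hwball : ∀ z ∈ closedBall x₀ ρ, hw z = G t₁ z := fun z hz => by
    rw [hhw]; simp only [ψ.one_of_mem_closedBall hz, one_mul]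
  -- the age offset from the approximate identity
  obtain ⟨σ₁, hσ₁, hAI⟩ :=
    upperOfMoments_exists_sub_le_heatExtension hwc hws (isCompact_closedBall x₀ ρ) hδ
  obtain ⟨σ₀, hσ₀_def⟩ : ∃ σ₀ : ℝ, σ₀ = min (σ₁ / 2) (ν * (t₁ - t)) := ⟨_, rfl⟩
  have hσ₀ : 0 < σ₀ := by rw [hσ₀_def]; exact lt_min (by linarith) hστ
  have hσ₀1 : σ₀ < σ₁ := by rw [hσ₀_def]; exact (min_le_left _ _).trans_lt (by linarith)
  have hσ₀τ : σ₀ ≤ ν * (t₁ - t) := by rw [hσ₀_def]; exact min_le_right _ _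
  refine ⟨σ₀, hσ₀, hσ₀τ, ?_⟩
  -- bookkeeping of the shifted age
  have hage : ∀ σ ∈ Icc 0 (ν * (t₁ - t)), 0 < σ + σ₀ := fun σ hσ => by linarith [hσ.1]
  have hshift : Continuous fun σ : ℝ => σ + σ₀ := by fun_prop
  have hmaps : MapsTo (fun σ : ℝ => σ + σ₀) (Icc 0 (ν * (t₁ - t))) (Ioi 0) := fun σ hσ =>
    hage σ hσ
  have hDφ : ∀ σ : ℝ, ∀ y : E,
      fderiv ℝ (fun y' => -driftKernelBarrier 1 (B / ν) hw (σ + σ₀) y' - δ) y =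
        -fderiv ℝ (driftKernelBarrier 1 (B / ν) hw (σ + σ₀)) y := by
    intro σ y
    rw [fderiv_sub_const, fderiv_fun_neg]
  have hΔφ : ∀ σ ∈ Icc 0 (ν * (t₁ - t)), ∀ y : E,
      (Δ fun y' => -driftKernelBarrier 1 (B / ν) hw (σ + σ₀) y' - δ) y =
        -(Δ (driftKernelBarrier 1 (B / ν) hw (σ + σ₀))) y := by
    intro σ hσ y
    have h2 : ContDiffAt ℝ 2 (-driftKernelBarrier 1 (B / ν) hw (σ + σ₀)) y :=
      (contDiff_driftKernelBarrier hwc hws (hage σ hσ)).contDiffAt.neg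
    have hfun : (fun y' => -driftKernelBarrier 1 (B / ν) hw (σ + σ₀) y' - δ) =
        -driftKernelBarrier 1 (B / ν) hw (σ + σ₀) - fun _ => δ := by
      funext y'
      simp only [Pi.sub_apply, Pi.neg_apply]
    rw [hfun, h2.laplacian_sub contDiffAt_const, InnerProductSpace.laplacian_const,
      InnerProductSpace.laplacian_neg]
    simp
  have key := hg.paraboloid_comparison (c := x₀) (t_b := 0) (t_T := ν * (t₁ - t))
    (P := fun _ => ρ ^ 2)
    (φ := fun σ y => -driftKernelBarrier 1 (B / ν) hw (σ + σ₀) y - δ)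
    (φt := fun σ y => -driftKernelBarrierDt 1 (B / ν) hw (σ + σ₀) y)
    isOpen_univ Subset.rfl continuous_const (fun _ _ _ _ => mem_univ _)
    ?_ ?_ ?_ ?_ ?_ ?_ ?_ ?_ ?_
  · -- conclusion at `σ = ν(t₁ − t)`, at the point `x`
    have hx2 : ‖x - x₀‖ ^ 2 ≤ ρ ^ 2 := pow_le_pow_left₀ (norm_nonneg _) hρx 2
    have h1 := key (ν * (t₁ - t)) ⟨hστ.le, le_rfl⟩ x hx2
    have e1 : t₁ - ν * (t₁ - t) / ν = t := by field_simp; ring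
    simp only [e1] at h1
    have hage' : 0 < ν * (t₁ - t) + σ₀ := hage _ ⟨hστ.le, le_rfl⟩
    have hint := upperOfMoments_integrable_mul_driftKernel hA hage' hGi x
    have h2 : driftKernelBarrier 1 (B / ν) hw (ν * (t₁ - t) + σ₀) x ≤
        ∫ z, G t₁ z * driftKernel 1 (B / ν) (ν * (t₁ - t) + σ₀) (x - z) :=
      driftKernelBarrier_le_integral hwc hws hage' x hint fun z =>
        mul_le_mul_of_nonneg_right (hwG z) (driftKernel_pos 1 (B / ν) hage' _).le
    linarith
  · -- joint continuity of the barrier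
    have h1 : ContinuousOn (fun q : ℝ × E => driftKernelBarrier 1 (B / ν) hw (q.1 + σ₀) q.2)
        (Icc 0 (ν * (t₁ - t)) ×ˢ univ) := by
      refine ContinuousOn.comp (g := fun p : ℝ × E => driftKernelBarrier 1 (B / ν) hw p.1 p.2)
        (f := fun q : ℝ × E => (q.1 + σ₀, q.2))
        (continuousOn_driftKernelBarrier hwc hws) (by fun_prop) ?_
      rintro ⟨σ, y⟩ ⟨hσ, -⟩
      exact ⟨hage σ hσ, mem_univ _⟩
    exact h1.neg.sub continuousOn_const
  · -- `C²` slices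
    intro σ hσ
    exact (contDiff_driftKernelBarrier hwc hws (hage σ hσ)).neg.sub contDiff_const
  · -- time derivative
    intro y σ hσ
    have h1 : HasDerivAt (fun σ' : ℝ => σ' + σ₀) 1 σ := by
      simpa using (hasDerivAt_id σ).add_const σ₀
    have hΨ' := (hasDerivAt_driftKernelBarrier_sigma (ε := 1) (A := B / ν) hwc hws
      (hage σ hσ) y).comp σ h1
    have h3 := hΨ'.neg.sub_const δ
    simp only [mul_one, Function.comp_def] at h3
    exact h3
  · -- continuity of the time derivative
    intro y
    exact ((continuousOn_driftKernelBarrierDt hwc hws y).comp hshift.continuousOn hmaps).neg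
  · -- continuity of the gradient in time
    intro y
    have h1 : ContinuousOn (fun σ => fderiv ℝ (driftKernelBarrier 1 (B / ν) hw (σ + σ₀)) y)
        (Icc 0 (ν * (t₁ - t))) :=
      (continuousOn_fderiv_driftKernelBarrier hwc hws y).comp hshift.continuousOn hmaps
    exact h1.neg.congr fun σ _ => hDφ σ y
  · -- continuity of the Laplacian in time
    intro y
    have h1 : ContinuousOn (fun σ => (Δ (driftKernelBarrier 1 (B / ν) hw (σ + σ₀))) y)
        (Icc 0 (ν * (t₁ - t))) :=
      (continuousOn_laplacian_driftKernelBarrier hwc hws y).comp hshift.continuousOn hmaps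
    exact h1.neg.congr fun σ hσ => hΔφ σ hσ y
  · -- the differential inequality `φₜ ≤ Δφ − A ‖∇φ‖` (supersolution `Ψ₊`)
    intro σ hσ y _
    have hσ' : σ ∈ Icc 0 (ν * (t₁ - t)) := ⟨hσ.1.le, hσ.2⟩
    rw [hΔφ σ hσ' y, hDφ σ y, norm_neg]
    have hBi := driftKernelBarrier_ineq (ε := 1) hwc hws hw0 (Or.inl rfl) hA (hage σ hσ') y
    linarith
  · -- bottom: `G(t₁) ≤ Ψ₊(σ₀) + δ` on the ball
    intro y hy
    have hyB : y ∈ closedBall x₀ ρ := mem_closedBall_of_norm_sq_le hρ0.le hy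
    simp only [zero_add, zero_div, sub_zero]
    have h1 := hAI σ₀ ⟨hσ₀, hσ₀1⟩ y hyB
    have h2 := upperOfMoments_heatExtension_le_driftKernelBarrier hA hwc hws hw0 hσ₀ y
    rw [hwball y hyB] at h1
    linarith
  · -- side: `v ≤ δ ≤ Ψ₊ + δ` for `‖y − x₀‖ = ρ ≥ ρ₀`
    intro σ hσ y hy
    have hyρ : ‖y - x₀‖ = ρ := (pow_left_inj₀ (norm_nonneg _) hρ0.le two_ne_zero).1 hy
    have hs : t₁ - σ / ν ∈ Icc t t₁ := by
      have h1 : 0 ≤ σ / ν := div_nonneg hσ.1 hν.le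
      have h2 : σ / ν ≤ t₁ - t := by rw [div_le_iff₀ hν]; linarith [hσ.2]
      exact ⟨by linarith, by linarith⟩
    have h1 : G (t₁ - σ / ν) y ≤ δ := hρ₀ _ hs y (by rw [hyρ]; exact hρρ₀)
    have h2 : 0 ≤ driftKernelBarrier 1 (B / ν) hw (σ + σ₀) y :=
      driftKernelBarrier_nonneg hw0 (hage σ hσ) y
    show -driftKernelBarrier 1 (B / ν) hw (σ + σ₀) y - δ ≤ -G (t₁ - σ / ν) y
    linarith

end General

/-! ### The registered sub-goal (dimension three) -/

/-- **Registered sub-goal `stub_prekernelBounds_comparison`** (the `ℝ³` form of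
`prekernel_comparison`, claim (iii) of STUB `stub_prekernelBounds` for the local class): if the
reversed rescaled `v(σ) = G(t₁ − σ/ν)` is in the local drift–heat class on the block
`[0, ν(t₁ − t)]` with drift bound `B/ν`, the top slice `G(t₁, ·)` is nonnegative, continuous and
integrable, and `G` decays at spatial infinity uniformly on `[t, t₁]`, then for every `x` and
`δ > 0` there is `σ₀ ∈ (0, ν(t₁ − t)]` with
`G(t, x) ≤ ∫ G(t₁, z) k₊(ν(t₁ − t) + σ₀, x − z) dz + δ`. -/
theorem stub_prekernelBounds_comparison :
    ∀ (ν t t₁ B : ℝ) (x₀ : EuclideanSpace ℝ (Fin 3)) (G : ℝ → EuclideanSpace ℝ (Fin 3) → ℝ), 0 < ν → t < t₁ → 0 ≤ B → (∃ a : ℝ → EuclideanSpace ℝ (Fin 3) → EuclideanSpace ℝ (Fin 3), IsDriftHeatSolutionOn a (fun σ => G (t₁ - σ / ν)) (B / ν) (Icc 0 (ν * (t₁ - t))) univ) → (∀ z, 0 ≤ G t₁ z) → Continuous (G t₁) → Integrable (G t₁) → (∀ δ : ℝ, 0 < δ → ∃ ρ₀ : ℝ, ∀ s ∈ Icc t t₁,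 ∀ y, ρ₀ ≤ ‖y - x₀‖ → G s y ≤ δ) → ∀ (x : EuclideanSpace ℝ (Fin 3)) (δ : ℝ), 0 < δ → ∃ σ₀ : ℝ, 0 < σ₀ ∧ σ₀ ≤ ν * (t₁ - t) ∧ G t x ≤ (∫ z, G t₁ z * driftKernel 1 (B / ν) (ν * (t₁ - t) + σ₀) (x - z)) + δ :=
  fun _ _ _ _ _ _ hν htt₁ hB0 hv hG0 hGc hGi hdecay x _ hδ =>
    prekernel_comparison hν htt₁ hB0 hv hG0 hGc hGi hdecay x hδ

end Summit.NavierStokesRegularity.NavierStokesRegularity.Theorems.AdaptedKernelExists.NashEntropyLastBlock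

end
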